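import Literature.AnabelianGeometry.EtaleTheta.Cyclotome
import Literature.AnabelianGeometry.SemiGraphs.TemperedCyclotomic
import Literature.IUT.LogVolume.TorsionUnits
import Literature.IUT.LogVolume.PadicSubfields
import Mathlib.FieldTheory.Galois.Infinite
import Mathlib.FieldTheory.Galois.Profinite
import HarnessLib

/-!
# No Galois-fixed points in the Tate module `Ẑ(1)` over a `p`-adic field

Classical input behind the «cyclotomic no-invariants» hypothesis used in the cell's [IUTchII] §1–2
files (`hfix` of `Literature.IUT.HodgeArakelov.h1LimRestrict_injective_of_forall_fixed_eq_one`,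
`…toLim_top_injective_of_forall_fixed_eq_one`, `…inftyClause_uniqueness_etaleThetaDataOfSetting'`):
**for a finite extension `K` of `ℚ_p` and an open — or merely finite-index — subgroup
`U ≤ G_K = Gal(K̄/K)`, the only `U`-fixed compatible system of roots of unity `(ζ_n)_{n ≥ 1}` in `K̄`
(`ζ_{nm}^m = ζ_n`, `ζ_n^n = 1`) is the trivial one; i.e. `Ẑ(1)^U = H⁰(U, Ẑ(1)) = 0`.**

Proof (Serre, *Corps locaux* / Neukirch *ANT* II (5.7): a `p`-adic field has finitely many roots
of unity): the closure `Ū` of `U` is open, its fixed field `L` is a finite extension of `K`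
(Krull; Mathlib `InfiniteGalois`), every `ζ_n` lies in `L`, and the roots of unity of the `p`-adic
field `L` are killed by one exponent `M` (the tree's `Literature.IUT.LogVolume.torsionUnits_le_rootsOfUnity`,
transported to an abstract finite extension of `ℚ_p` through an embedding into `ℚ̄_p`); hence
`ζ_n = ζ_{nM}^M = 1`.

Contents (theorems only, no definitions, no named facts; a compatible system killed by one
exponent is trivial — private helper):
* `exists_exponent_rootsOfUnity_padicSubfield`, `exists_exponent_rootsOfUnity_of_finiteDimensional`
  — a finite extension of `ℚ_p` (inside `ℚ̄_p`, resp. abstract) has a uniform exponent killing all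
  its roots of unity;
* `algClosure_compatibleRoots_eq_one_of_isOpen` / `…_of_finiteIndex` — `Ẑ(1)^U = 1` for `U ≤ G_K`
  open, resp. of finite index (`K/ℚ_p` finite, `K̄ = AlgebraicClosure K`, `G_K = K̄ ≃ₐ[K] K̄` with
  the Krull topology = `Field.absoluteGaloisGroup K`; for `K = ℚ_p` this is the cell's `GQp p`);
  `cyclotome_algClosure_eq_one_of_finiteIndex` is the same for the tree's `cyclotome (K̄^×)`
  (`Cyclotome.lean`); `padicAlgCl_compatibleRoots_eq_one_of_finiteIndex_in_fixingSubgroup` is the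
  curve-level form over `ℚ̄_p = PadicAlgCl p` (`U ∩ G_E` of finite index in `G_E = E.fixingSubgroup`,
  `E ⊆ ℚ̄_p` finite — the shape of `TemperedCurve.range_aug`);
* `IsTateTwist.eq_one_of_forall_act_eq` — over the [SemiAnbd]/[EtTh] group-level interface
  `OncePuncturedTemperedGroup K` ([EtTh] §1 p. 238 "`Δ_Θ ≅ Ẑ(1)`", typed as
  `OncePuncturedTemperedGroup.IsTateTwist`): an element of a Tate-twist subgroup `T` fixed by a
  subgroup `N ≤ Π^tp_X` whose image in `G_K` has finite index inside some open subgroup is trivial —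
  the exact shape of `hfix` at the group level, so that `hfix` = the admissible named fact
  `DeltaThetaIsoTate` ([EtTh] §1 p. 238) + this file.

Classical; nothing disputed; no side taken on any claim of [IUTchI–IV].
-/

noncomputable section

open Literature.IUT.LogVolume

namespace Literature.AnabelianGeometry.EtaleTheta

universe u

/-! ### Compatible systems killed by a uniform exponent are trivial -/

section Uniform

variable {M : Type*} [Monoid M]

/-- If `ζ_{nm}^m = ζ_n` for all `n, m ≥ 1` and one exponent `N ≥ 1` kills every `ζ_n`, then every
`ζ_n = ζ_{nN}^N` is trivial. [folklore] -/
private theorem compatibleRoots_eq_one_of_pow_eq_one (ζ : ℕ → M)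
    (hcompat : ∀ n m : ℕ, 0 < n → 0 < m → ζ (n * m) ^ m = ζ n) {N : ℕ} (hN : 0 < N)
    (hkill : ∀ n, 0 < n → ζ n ^ N = 1) (n : ℕ) (hn : 0 < n) : ζ n = 1 := by
  rw [← hcompat n N hn hN]
  exact hkill (n * N) (Nat.mul_pos hn hN)

end Uniform

/-! ### A finite extension of `ℚ_p` has a uniform exponent for its roots of unity -/

section Padic

variable (p : ℕ) [Fact p.Prime]

/-- **Roots of unity of a finite `E ⊆ ℚ̄_p` are killed by one exponent**: `∃ M ≥ 1`, `x^M = 1` for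
every `x ∈ E` of finite order (the torsion `R^μ` of `E^×` is finite, Neukirch *ANT* II (5.7) (i); tree:
`Literature.IUT.LogVolume.torsionUnits_le_rootsOfUnity`, the `ProperSpace` instance being the scoped
`properSpace_subfield` of `PadicSubfields.lean`). [cite: NeukirchANT1999, Ch. II Prop. (5.7) (i)] -/
theorem exists_exponent_rootsOfUnity_padicSubfield (E : IntermediateField ℚ_[p] (PadicAlgCl p))
    [FiniteDimensional ℚ_[p] E] :
    ∃ M : ℕ, 0 < M ∧ ∀ x : E, IsOfFinOrder x → x ^ M = 1 := by
  obtain ⟨M, hM, hle⟩ := torsionUnits_le_rootsOfUnity p (↥E)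
  refine ⟨M, hM, fun x hx => ?_⟩
  obtain ⟨n, hn, hxn⟩ := isOfFinOrder_iff_pow_eq_one.mp hx
  set u : (↥E)ˣ := hx.isUnit.unit with hu
  have huval : (u : E) = x := hx.isUnit.unit_spec
  have hufin : IsOfFinOrder u :=
    isOfFinOrder_iff_pow_eq_one.mpr ⟨n, hn, Units.ext (by
      rw [Units.val_pow_eq_pow_val, huval, hxn, Units.val_one])⟩
  have humem : u ∈ rootsOfUnity M (↥E) := hle ((CommGroup.mem_torsion u).mpr hufin)
  rw [mem_rootsOfUnity] at humem
  have := congrArg (fun v : (↥E)ˣ => (v : E)) humem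
  simpa only [Units.val_pow_eq_pow_val, huval, Units.val_one] using this

/-- **Roots of unity of an (abstract) finite extension `K/ℚ_p` are killed by one exponent**:
`∃ M ≥ 1`, `x^M = 1` for every `x ∈ K` of finite order — transported from
`exists_exponent_rootsOfUnity_padicSubfield` along an embedding `K ↪ ℚ̄_p` (`IsAlgClosed.lift`).
[cite: NeukirchANT1999, Ch. II Prop. (5.7) (i)] -/
theorem exists_exponent_rootsOfUnity_of_finiteDimensional (K : Type u) [Field K] [Algebra ℚ_[p] K]
    [FiniteDimensional ℚ_[p] K] :
    ∃ M : ℕ, 0 < M ∧ ∀ x : K, IsOfFinOrder x → x ^ M = 1 := by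
  haveI : Algebra.IsAlgebraic ℚ_[p] K := Algebra.IsAlgebraic.of_finite ℚ_[p] K
  let j : K →ₐ[ℚ_[p]] PadicAlgCl p := IsAlgClosed.lift
  let E : IntermediateField ℚ_[p] (PadicAlgCl p) := (⊤ : IntermediateField ℚ_[p] K).map j
  let e : K ≃ₐ[ℚ_[p]] E := IntermediateField.topEquiv.symm.trans (IntermediateField.equivMap ⊤ j)
  haveI : FiniteDimensional ℚ_[p] E := LinearEquiv.finiteDimensional e.toLinearEquiv
  obtain ⟨M, hM, hE⟩ := exists_exponent_rootsOfUnity_padicSubfield p E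
  refine ⟨M, hM, fun x hx => ?_⟩
  obtain ⟨n, hn, hxn⟩ := isOfFinOrder_iff_pow_eq_one.mp hx
  have hex : IsOfFinOrder (e x) :=
    isOfFinOrder_iff_pow_eq_one.mpr ⟨n, hn, by rw [← map_pow, hxn, map_one]⟩
  have h := hE (e x) hex
  rw [← map_pow] at h
  exact e.injective (h.trans (map_one e).symm)

end Padic

/-! ### `Ẑ(1)^U = 1` for `U ≤ G_K` open or of finite index, `K/ℚ_p` finite -/

/-- «Finite index inside an open subgroup» ⇒ «finite index», in a compact topological group: if
`V` is open (hence of finite index) and `U ∩ V` has finite index in `V`, then `U` has finite index.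
[folklore] -/
private theorem finiteIndex_of_subgroupOf_finiteIndex_of_isOpen {G : Type*} [Group G]
    [TopologicalSpace G] [IsTopologicalGroup G] [CompactSpace G] (V U : Subgroup G)
    (hV : IsOpen (V : Set G)) [(U.subgroupOf V).FiniteIndex] : U.FiniteIndex := by
  haveI : Finite (G ⧸ V) := Subgroup.quotient_finite_of_isOpen V hV
  haveI : V.FiniteIndex := Subgroup.finiteIndex_of_finite_quotient
  haveI : (U ⊓ V).FiniteIndex := by
    rw [← Subgroup.subgroupOf_map_subtype]
    refine ⟨?_⟩
    rw [Subgroup.index_map_subtype]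
    exact Nat.mul_ne_zero Subgroup.FiniteIndex.index_ne_zero Subgroup.FiniteIndex.index_ne_zero
  exact Subgroup.finiteIndex_of_le (inf_le_left : U ⊓ V ≤ U)

section Galois

variable (p : ℕ) [Fact p.Prime] (K : Type u) [Field K] [Algebra ℚ_[p] K] [FiniteDimensional ℚ_[p] K]

include p

/-- **`H⁰(U, Ẑ(1)) = 0` for an open subgroup `U ≤ G_K = Gal(K̄/K)`, `K/ℚ_p` finite**: a family
`(ζ_n)_{n ≥ 1}` of roots of unity of `K̄ = AlgebraicClosure K` with `ζ_{nm}^m = ζ_n`, all fixed by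
`U`, is trivial.  (The fixed field of `U` is a finite extension `L` of `K` — Krull topology, Mathlib
`InfiniteGalois` —, all `ζ_n ∈ L`, and the roots of unity of the `p`-adic field `L` have a uniform
exponent.)  For `K = ℚ_p` the group is the cell's `GQp p`.
[cite: NeukirchANT1999, Ch. II Prop. (5.7) (i)] -/
theorem algClosure_compatibleRoots_eq_one_of_isOpen
    (U : Subgroup (AlgebraicClosure K ≃ₐ[K] AlgebraicClosure K))
    (hU : IsOpen (U : Set (AlgebraicClosure K ≃ₐ[K] AlgebraicClosure K)))
    (ζ : ℕ → AlgebraicClosure K)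
    (hcompat : ∀ n m : ℕ, 0 < n → 0 < m → ζ (n * m) ^ m = ζ n)
    (htor : ∀ n, 0 < n → ζ n ^ n = 1)
    (hfix : ∀ σ ∈ U, ∀ n, 0 < n → σ (ζ n) = ζ n) (n : ℕ) (hn : 0 < n) : ζ n = 1 := by
  classical
  haveI : CharZero K := charZero_of_injective_algebraMap (algebraMap ℚ_[p] K).injective
  set L : IntermediateField K (AlgebraicClosure K) := IntermediateField.fixedField U with hLdef
  have hLU : L.fixingSubgroup = U :=
    InfiniteGalois.fixingSubgroup_fixedField ⟨U, U.isClosed_of_isOpen hU⟩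
  haveI : FiniteDimensional K L := by
    refine (InfiniteGalois.isOpen_iff_finite L).mp ?_
    change IsOpen (L.fixingSubgroup : Set (AlgebraicClosure K ≃ₐ[K] AlgebraicClosure K))
    rw [hLU]
    exact hU
  haveI : FiniteDimensional ℚ_[p] L := FiniteDimensional.trans ℚ_[p] K L
  obtain ⟨M, hM, hkill⟩ := exists_exponent_rootsOfUnity_of_finiteDimensional p (↥L)
  refine compatibleRoots_eq_one_of_pow_eq_one ζ hcompat hM (fun k hk => ?_) n hn
  have hmem : ζ k ∈ L := by
    rw [hLdef, IntermediateField.mem_fixedField_iff]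
    exact fun σ hσ => hfix σ hσ k hk
  have hfo : IsOfFinOrder (⟨ζ k, hmem⟩ : L) :=
    isOfFinOrder_iff_pow_eq_one.mpr ⟨k, hk, Subtype.ext (by
      rw [SubmonoidClass.coe_pow]
      exact htor k hk)⟩
  have h := congrArg (fun y : L => (y : AlgebraicClosure K)) (hkill _ hfo)
  simpa only [SubmonoidClass.coe_pow, OneMemClass.coe_one] using h

/-- **`H⁰(U, Ẑ(1)) = 0` for a subgroup `U ≤ G_K` of FINITE INDEX (not necessarily closed),
`K/ℚ_p` finite**: a `U`-fixed compatible family of roots of unity of `K̄` is trivial.  (The closure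
`Ū` is closed of finite index, hence open; stabilisers of elements of `K̄` are closed, so `Ū` still
fixes every `ζ_n`; apply `algClosure_compatibleRoots_eq_one_of_isOpen`.)
[cite: NeukirchANT1999, Ch. II Prop. (5.7) (i)] -/
theorem algClosure_compatibleRoots_eq_one_of_finiteIndex
    (U : Subgroup (AlgebraicClosure K ≃ₐ[K] AlgebraicClosure K)) [U.FiniteIndex]
    (ζ : ℕ → AlgebraicClosure K)
    (hcompat : ∀ n m : ℕ, 0 < n → 0 < m → ζ (n * m) ^ m = ζ n)
    (htor : ∀ n, 0 < n → ζ n ^ n = 1)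
    (hfix : ∀ σ ∈ U, ∀ n, 0 < n → σ (ζ n) = ζ n) (n : ℕ) (hn : 0 < n) : ζ n = 1 := by
  set V := U.topologicalClosure with hVdef
  haveI : V.FiniteIndex := Subgroup.finiteIndex_of_le U.le_topologicalClosure
  have hV : IsOpen (V : Set (AlgebraicClosure K ≃ₐ[K] AlgebraicClosure K)) :=
    V.isOpen_of_isClosed_of_finiteIndex U.isClosed_topologicalClosure
  refine algClosure_compatibleRoots_eq_one_of_isOpen p K V hV ζ hcompat htor
    (fun σ hσ k hk => ?_) n hn
  -- `U ≤ Gal(K̄/K(ζ_k))`, a closed subgroup, hence `Ū ≤ Gal(K̄/K(ζ_k))`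
  haveI : FiniteDimensional K (IntermediateField.adjoin K {ζ k}) :=
    IntermediateField.adjoin.finiteDimensional
      (Algebra.IsAlgebraic.isAlgebraic (R := K) (ζ k)).isIntegral
  have hle : U ≤ (IntermediateField.adjoin K {ζ k}).fixingSubgroup := by
    rw [← IntermediateField.le_iff_le, IntermediateField.adjoin_le_iff, Set.singleton_subset_iff,
      SetLike.mem_coe, IntermediateField.mem_fixedField_iff]
    exact fun τ hτ => hfix τ hτ k hk
  have hVle : V ≤ (IntermediateField.adjoin K {ζ k}).fixingSubgroup :=
    U.topologicalClosure_minimal hle (IntermediateField.fixingSubgroup_isClosed _)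
  exact (mem_fixingSubgroup_iff _).mp (hVle hσ) (ζ k)
    (IntermediateField.mem_adjoin_simple_self K (ζ k))

/-- The same in the vocabulary of the tree's cyclotome `Λ(K̄^×) = lim_n μ_n(K̄)`
(`EtaleTheta.cyclotome`, componentwise Galois action): **an element of `Λ(K̄^×)` fixed by a
finite-index subgroup of `G_K` is trivial** (`K/ℚ_p` finite). [cite: NeukirchANT1999, Ch. II Prop. (5.7) (i)] -/
theorem cyclotome_algClosure_eq_one_of_finiteIndex
    (U : Subgroup (AlgebraicClosure K ≃ₐ[K] AlgebraicClosure K)) [U.FiniteIndex]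
    (ζ : cyclotome (AlgebraicClosure K)ˣ)
    (hfix : ∀ σ ∈ U, ∀ n : ℕ+,
      σ (((ζ : ℕ+ → (AlgebraicClosure K)ˣ) n : (AlgebraicClosure K)ˣ) : AlgebraicClosure K) =
        ((ζ : ℕ+ → (AlgebraicClosure K)ˣ) n : (AlgebraicClosure K)ˣ)) :
    ζ = 1 := by
  classical
  set f : ℕ → AlgebraicClosure K := fun n =>
    if h : 0 < n then (((ζ : ℕ+ → (AlgebraicClosure K)ˣ) ⟨n, h⟩ : (AlgebraicClosure K)ˣ) :
      AlgebraicClosure K) else 1 with hf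
  have hcompat : ∀ n m : ℕ, 0 < n → 0 < m → f (n * m) ^ m = f n := by
    intro n m hn hm
    simp only [hf, dif_pos hn, dif_pos (Nat.mul_pos hn hm), ← Units.val_pow_eq_pow_val]
    exact congrArg Units.val (cyclotome.pow_apply_mul ζ ⟨n, hn⟩ ⟨m, hm⟩)
  have htor : ∀ n, 0 < n → f n ^ n = 1 := by
    intro n hn
    have h1 := cyclotome.pow_eq_one ζ ⟨n, hn⟩
    rw [PNat.mk_coe] at h1
    simp only [hf, dif_pos hn, ← Units.val_pow_eq_pow_val, h1, Units.val_one]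
  have hfix' : ∀ σ ∈ U, ∀ n, 0 < n → σ (f n) = f n := by
    intro σ hσ n hn
    simp only [hf, dif_pos hn]
    exact hfix σ hσ ⟨n, hn⟩
  have h := algClosure_compatibleRoots_eq_one_of_finiteIndex p K U f hcompat htor hfix'
  refine Subtype.ext (funext fun n => Units.val_eq_one.mp ?_)
  have hfn := h n n.pos
  simp only [hf, dif_pos n.pos] at hfn
  exact hfn

end Galois

section PadicAlgCl

variable (p : ℕ) [Fact p.Prime]

/-- **Curve-level form** (the cell's `TemperedCurve`/`ThetaSetting` interface: `G_{ℚ_p} = GQp p =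
ℚ̄_p ≃ₐ[ℚ_p] ℚ̄_p`, `G_E = E.fixingSubgroup` for the finite `E ⊆ ℚ̄_p = PadicAlgCl p`): a compatible
family of roots of unity of `ℚ̄_p` fixed by a subgroup `U ≤ G_{ℚ_p}` such that `U ∩ G_E` has finite
index in `G_E` is trivial (`G_E` is open, so `U` has finite index in the compact `G_{ℚ_p}`).
[cite: NeukirchANT1999, Ch. II Prop. (5.7) (i)] -/
theorem padicAlgCl_compatibleRoots_eq_one_of_finiteIndex_in_fixingSubgroup
    (E : IntermediateField ℚ_[p] (PadicAlgCl p)) [FiniteDimensional ℚ_[p] E]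
    (U : Subgroup (PadicAlgCl p ≃ₐ[ℚ_[p]] PadicAlgCl p))
    [(U.subgroupOf E.fixingSubgroup).FiniteIndex]
    (ζ : ℕ → PadicAlgCl p)
    (hcompat : ∀ n m : ℕ, 0 < n → 0 < m → ζ (n * m) ^ m = ζ n)
    (htor : ∀ n, 0 < n → ζ n ^ n = 1)
    (hfix : ∀ σ ∈ U, ∀ n, 0 < n → σ (ζ n) = ζ n) (n : ℕ) (hn : 0 < n) : ζ n = 1 := by
  haveI : U.FiniteIndex :=
    finiteIndex_of_subgroupOf_finiteIndex_of_isOpen E.fixingSubgroup U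
      (IntermediateField.fixingSubgroup_isOpen E)
  exact algClosure_compatibleRoots_eq_one_of_finiteIndex p ℚ_[p] U ζ hcompat htor hfix n hn

end PadicAlgCl

/-! ### The group-level interface: fixed elements of a Tate twist are trivial -/

section TateTwist

open Literature.AnabelianGeometry.SemiGraphs
open Literature.AnabelianGeometry.SemiGraphs.OncePuncturedTemperedGroup

variable (p : ℕ) [Fact p.Prime] {K : Type u} [Field K] [Algebra ℚ_[p] K] [FiniteDimensional ℚ_[p] K]

include p

/-- **Fixed elements of a Tate twist are trivial** ([EtTh] §1 p. 238 "`Δ_Θ (≅ Ẑ(1))`", at the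
[SemiAnbd] §6 group-level interface `OncePuncturedTemperedGroup K`, `K/ℚ_p` finite): if
`T` with the action `act` of `Π^tp_X` *is a Tate twist* (`IsTateTwist`: level maps
`ι_n : T → μ_n(K̄)`, compatible, jointly injective, `aug`-equivariant) and `t ∈ T` is fixed by every
element of a subgroup `N ≤ Π^tp_X` whose image `aug(N)` meets some OPEN subgroup `V ≤ G_K` (e.g.
`V = G_K`, or `V = Gal(K̄/K')` for a finite `K'/K`) in a subgroup of finite index of `V`, then
`t = 1`: `aug(N)` has finite index in the compact `G_K`, the `ι_n(t)` form a compatible system of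
roots of unity fixed by `aug(N)`, trivial by `algClosure_compatibleRoots_eq_one_of_finiteIndex`, and
the `ι_n` are jointly injective.  This is the shape of the hypothesis `hfix` («no element `≠ 1` of
`(l·Δ_Θ)` is fixed by `Π_Ÿ ∩ K'`, `K'` of finite index») of the cell's [IUTchII] Cor 1.12 /
Prop 2.2 (ii) model files, which thereby reduces to the named fact `DeltaThetaIsoTate`
([EtTh] §1 p. 238). [cite: MochizukiEtTh2009, §1 p.238] -/
theorem IsTateTwist.eq_one_of_forall_act_eq (D : OncePuncturedTemperedGroup K)
    {A : Type u} [Group A] [TopologicalSpace A] {T : Subgroup A} {act : D.Pi → A →* A}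
    {hact : ∀ g, ∀ t ∈ T, act g t ∈ T} (hT : D.IsTateTwist T act hact)
    (N : Subgroup D.Pi) (V : Subgroup (Field.absoluteGaloisGroup K))
    (hV : IsOpen (V : Set (Field.absoluteGaloisGroup K)))
    (hN : ((N.map D.aug.toMonoidHom).subgroupOf V).FiniteIndex)
    (t : T) (ht : ∀ g ∈ N, act g t = t) : t = 1 := by
  -- `G_K = Field.absoluteGaloisGroup K` is by definition `K̄ ≃ₐ[K] K̄` with the Krull topology
  haveI : CharZero K := charZero_of_injective_algebraMap (algebraMap ℚ_[p] K).injective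
  set U : Subgroup (AlgebraicClosure K ≃ₐ[K] AlgebraicClosure K) := N.map D.aug.toMonoidHom
    with hUdef
  set V' : Subgroup (AlgebraicClosure K ≃ₐ[K] AlgebraicClosure K) := V with hV'def
  have hV' : IsOpen (V' : Set (AlgebraicClosure K ≃ₐ[K] AlgebraicClosure K)) := hV
  haveI : (U.subgroupOf V').FiniteIndex := hN
  haveI : U.FiniteIndex := finiteIndex_of_subgroupOf_finiteIndex_of_isOpen V' U hV'
  obtain ⟨ι, hpow, -, -, hcompat, hinj, hequiv⟩ := hT
  -- the compatible family of roots of unity `ζ_n := ι_n(t)` in `K̄`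
  set ζ : ℕ → AlgebraicClosure K := fun n => ((ι n t : (AlgebraicClosure K)ˣ) : AlgebraicClosure K)
    with hζ
  have hζcompat : ∀ n m : ℕ, 0 < n → 0 < m → ζ (n * m) ^ m = ζ n := by
    intro n m hn hm
    simp only [hζ, ← Units.val_pow_eq_pow_val, hcompat n m hn hm t]
  have hζtor : ∀ n, 0 < n → ζ n ^ n = 1 := by
    intro n hn
    simp only [hζ, ← Units.val_pow_eq_pow_val, hpow n hn t, Units.val_one]
  have hζfix : ∀ σ ∈ U, ∀ n, 0 < n → σ (ζ n) = ζ n := by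
    intro σ hσ n hn
    rw [hUdef] at hσ
    obtain ⟨g, hg, rfl⟩ := Subgroup.mem_map.mp hσ
    have htg : (⟨act g t, hact g t t.2⟩ : T) = t := Subtype.ext (ht g hg)
    have h := hequiv n hn g t
    rw [htg] at h
    exact h.symm
  have hζone := algClosure_compatibleRoots_eq_one_of_finiteIndex p K U ζ hζcompat hζtor hζfix
  refine hinj t fun n hn => ?_
  exact Units.val_eq_one.mp (hζone n hn)

end TateTwist

end Literature.AnabelianGeometry.EtaleTheta
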